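import Summits.QuantumFields.BalabanUV.T4Continuum.Support.NE3CovariantCompetitor
import Summits.QuantumFields.BalabanUV.T4Continuum.Support.NE3TentBumpSharp
import Summits.QuantumFields.BalabanUV.T4Continuum.Support.NE3TentMeanDefectSharp
import HarnessLib

/-!
# T⁴ programme, node NE3 — row E-MLw-(w4)-P-curved, route H♮, row K5c♯ (file F♯3): THE S7 COMPETITOR'S ENERGY WITH THE SHARP TENT
# CONSTANTS — file 5's END re-assembled, binder-identical

NE3 (node U1b) formalisation swarm, leaf seat `b2b-balaban-t4-ne3-formalise-leaf-01` (gen 7); row **K5** of ruling ρ-g22-2, sub-row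
**K5c♯** = LEVER (4) of the (P♮)_W census (D-ne3r2-g10-2 (4), `HOME/CLAIMS.log` l.20809: «f4∕f5∕6b's TENT CONSTANTS `64^d·2^{3d+2}`
(A₁ = 2.6e13) … the largest remaining lever by far»; INTENT l.20912), file F♯3 over F♯1 `NE3TentBumpSharp` (the bump's exact Dirichlet
energy against `tentSum²`) and F♯2b `NE3TentMeanDefectSharp` (the ℓ²-isometric mean defect).  Same object `competitorW M W b c`, same
hypotheses as file 5's `sum_normSq_gaugeDir_competitorW_le`; only the constants of the bump term change.

CONTENT ([folklore]; 0 sorry; 0 def), `[Nonempty n]`, `M ≥ 2`, `N ≥ 1`, `d ≥ 1`; `W`, `U` unitary, `SmallField W a`, `SmallField U a_U`,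
`‖U − bseg M W‖ ≤ δ` bondwise, `U`, `b`, `c` `N`-periodic; letters `D = Σ_zΣ_α ‖gaugeDir U b z α‖²`, `S_b = Σ_z ‖b z‖²`, `S_h = Σ_z ‖c z − b z‖²`,
`κ_a = 2(d−1)(M−1)a`, `K₁ = 8(dMa)² + (16∕M²)(δ + 9d²M²a)²`, `K♯ = 16d²(d−1)²a_U² + 8(9d²M²a + dδ)²`:
§1 `norm_compCoef_le_tentSum` (`‖compCoef‖ ≤ tentSum⁻¹·(M^d·‖defect‖ + ‖c − b‖)`, no `8^d`) and
   `tentSum_sq_mul_sum_normSq_compCoef_le` (`tentSum²·Σ‖compCoef‖² ≤ 2M^{2d}·(4d·D + K♯·S_b) + 2·S_h`);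
§2 **THE END `sum_normSq_gaugeDir_competitorW_le_sharp`**:
   `Σ_{y∈periodBox(M·N)}Σ_α ‖gaugeDir W (competitorW M W b c) y α‖²
      ≤ 3·(2^{d+1}(M^d∕M²)·D + d·2^d·M^d·K₁·S_b) + 12d·S_h + 3·(d·2^{d+2}·(8∕M² + κ_a²))·(M^d·(4d·D + K♯·S_b) + (M^d)⁻¹·S_h)`
   — against file 5's bump term `3·(d·M^d·κ²)·(2·64^d·(2^{3d+2}d·D + 2^d·K₂·S_b) + 2·64^d·((M^d)⁻¹)²·S_h)` the `M^{d−2}·D` coefficient drops from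
   `6d²·64^d·2^{3d+2}` (2.6e13 at d = 4) to `96d²·2^{d+2}` (9.8e4 at d = 4, plus `3·2^{d+1} = 96` from the interpolant) — ≈ 8.4 orders, k-FREE.

HONEST FRAMING.  Kinematics of OUR competitor at one background in the small-field class; nothing about Bałaban's minimisers;
(P♮)_W ∕ (ML_w) at W ≠ 1, T-E_w and **NE3 are NOT proved**; spine PROVED 0∕9; finite T⁴ rung (B)+1 — NOT infinite volume, NOT
mass gap, NOT `BetaPertH`, NOT Clay.  PLACEMENT: `Summits/QuantumFields/BalabanUV/`.  HONEST DEPENDENCY (cell page 1): continuum YM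
on T⁴ ⇐ BetaPertH ∧ nine spine estimates (0/9 proved); BetaPertH ⇐ (D1) ∧ (D4) ∧ CAP+tail; G-an2-4 gates asym, D1 and NE2/3/4.
-/

set_option autoImplicit false

open scoped BigOperators Matrix.Norms.L2Operator
open Finset

namespace Summit.QuantumFields.BalabanUV.T4Continuum.NE3CovariantCompetitorSharp

open Literature.MathematicalPhysics.QuantumFieldTheory.Balaban1983to89
open B7Prop1Explicit B7Prop2Explicit
open T4AveragingDeficitWall (IsUnitaryCfg SmallField Ad)
open T4AveragingDeficitWallBoundary (periodBox mem_periodBox card_periodBox IsPeriodicCfg sum_periodBox_shift)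
open AveragingDeficitBlockDensity (btree bseg)
open BlockAveragePushDirGauge (gaugeDir)
open NE3TentBump (tentSum tentSum_pos bump)
open NE3CovariantBlockMean (bmeanW)
open NE3DressedBlockField (dressW)
open NE3CovariantTentInterpolant (tinterpW)
open NE3CovariantTentInterpolantEnergy (sum_normSq_gaugeDir_tinterpW_le)
open NE3CornerSpikes (spikeW sum_normSq_gaugeDir_spikeW_le)
open NE3CovariantCompetitor (compCoef competitorW gaugeDir_add')
open NE3TentBumpSharp (sum_normSq_gaugeDir_dressW_bump_le_tentSum)
open NE3TentMeanDefectSharp (sum_normSq_sub_bmeanW_tinterpW_le_sharp)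

noncomputable section

variable {d : ℕ} {n : Type*} [Fintype n] [DecidableEq n] [Nonempty n]

/-! ## §1 The coefficient against `tentSum` -/

omit [Nonempty n] in
/-- The competitor's coefficient without the `8^d`: `‖compCoef M W b c z‖ ≤ tentSum⁻¹·(M^d·‖b z − bmeanW M W (tinterpW M W b) z‖ + ‖c z − b z‖)`
(`M ≥ 2`). [folklore] -/
theorem norm_compCoef_le_tentSum {M : ℕ} (hM : 2 ≤ M) (W : Site d → Fin d → (Matrix n n ℂ)ˣ) (b c : Site d → Matrix n n ℂ) (z : Site d) :
    ‖compCoef M W b c z‖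
      ≤ (tentSum d M)⁻¹ * ((M : ℝ) ^ d * ‖b z - bmeanW M W (tinterpW M W b) z‖ + ‖c z - b z‖) := by
  have hM0 : (0 : ℝ) ≤ (M : ℝ) ^ d := by positivity
  have hTS := tentSum_pos hM d
  unfold compCoef
  rw [norm_smul, Real.norm_of_nonneg (inv_nonneg.mpr hTS.le)]
  refine mul_le_mul_of_nonneg_left ((norm_sub_le _ _).trans ?_) (inv_nonneg.mpr hTS.le)
  rw [norm_smul, Real.norm_of_nonneg hM0]

/-- **THE COEFFICIENT IN ℓ² AGAINST `tentSum²`** (same binders as the END):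
`tentSum²·Σ_z ‖compCoef M W b c z‖² ≤ 2·M^{2d}·(4d·D + K♯·S_b) + 2·S_h`. [folklore] -/
theorem tentSum_sq_mul_sum_normSq_compCoef_le {M N : ℕ} (hM : 2 ≤ M) (hN : 1 ≤ N) (hd : 0 < d)
    {W U : Site d → Fin d → (Matrix n n ℂ)ˣ} (hW : IsUnitaryCfg W) (hU : IsUnitaryCfg U) {a aU δ : ℝ} (ha : 0 ≤ a) (haU : 0 ≤ aU)
    (hWa : SmallField W a) (hUa : SmallField U aU)
    (hδ : ∀ (w : Site d) (α : Fin d), ‖((U w α : (Matrix n n ℂ)ˣ) : Matrix n n ℂ) - bseg M W w α‖ ≤ δ)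
    (hUP : IsPeriodicCfg U (N : ℤ)) {b : Site d → Matrix n n ℂ}
    (hb : ∀ (z : Site d) (τ : Fin d), b (z + (N : ℤ) • e τ) = b z) (c : Site d → Matrix n n ℂ) :
    tentSum d M ^ 2 * ∑ z ∈ periodBox (d := d) N, ‖compCoef M W b c z‖ ^ 2
      ≤ 2 * ((M : ℝ) ^ d) ^ 2
            * (4 * (d : ℝ) * ∑ z ∈ periodBox (d := d) N, ∑ α : Fin d, ‖gaugeDir U b z α‖ ^ 2
              + (16 * (d : ℝ) ^ 2 * (((d : ℝ) - 1) * aU) ^ 2 + 8 * (9 * (d : ℝ) ^ 2 * (M : ℝ) ^ 2 * a + (d : ℝ) * δ) ^ 2)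
                * ∑ z ∈ periodBox (d := d) N, ‖b z‖ ^ 2)
        + 2 * ∑ z ∈ periodBox (d := d) N, ‖c z - b z‖ ^ 2 := by
  have hM1 : 1 ≤ M := by omega
  have hδ0 : 0 ≤ δ := (norm_nonneg _).trans (hδ 0 ⟨0, hd⟩)
  have hTS := tentSum_pos hM d
  have hdef := sum_normSq_sub_bmeanW_tinterpW_le_sharp hM1 hN hW hU ha haU hδ0 hWa hUa hδ hUP hb
  -- pointwise: `tentSum²·‖compCoef‖² ≤ 2M^{2d}‖defect‖² + 2‖c − b‖²`
  have hpt : ∀ z : Site d, tentSum d M ^ 2 * ‖compCoef M W b c z‖ ^ 2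
      ≤ 2 * ((M : ℝ) ^ d) ^ 2 * ‖b z - bmeanW M W (tinterpW M W b) z‖ ^ 2 + 2 * ‖c z - b z‖ ^ 2 := by
    intro z
    have h := norm_compCoef_le_tentSum hM W b c z
    have h' : tentSum d M * ‖compCoef M W b c z‖ ≤ (M : ℝ) ^ d * ‖b z - bmeanW M W (tinterpW M W b) z‖ + ‖c z - b z‖ := by
      have := mul_le_mul_of_nonneg_left h hTS.le
      rwa [← mul_assoc, mul_inv_cancel₀ hTS.ne', one_mul] at this
    have h0 : 0 ≤ tentSum d M * ‖compCoef M W b c z‖ := by positivity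
    calc tentSum d M ^ 2 * ‖compCoef M W b c z‖ ^ 2 = (tentSum d M * ‖compCoef M W b c z‖) ^ 2 := by ring
      _ ≤ ((M : ℝ) ^ d * ‖b z - bmeanW M W (tinterpW M W b) z‖ + ‖c z - b z‖) ^ 2 := pow_le_pow_left₀ h0 h' 2
      _ ≤ _ := by nlinarith [sq_nonneg ((M : ℝ) ^ d * ‖b z - bmeanW M W (tinterpW M W b) z‖ - ‖c z - b z‖)]
  have hsum : tentSum d M ^ 2 * ∑ z ∈ periodBox (d := d) N, ‖compCoef M W b c z‖ ^ 2
      ≤ 2 * ((M : ℝ) ^ d) ^ 2 * ∑ z ∈ periodBox (d := d) N, ‖b z - bmeanW M W (tinterpW M W b) z‖ ^ 2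
        + 2 * ∑ z ∈ periodBox (d := d) N, ‖c z - b z‖ ^ 2 := by
    rw [Finset.mul_sum]
    refine (Finset.sum_le_sum fun z _ => hpt z).trans (le_of_eq ?_)
    rw [Finset.sum_add_distrib, ← Finset.mul_sum, ← Finset.mul_sum]
  have hM2d : (0 : ℝ) ≤ 2 * ((M : ℝ) ^ d) ^ 2 := by positivity
  linarith [hsum, mul_le_mul_of_nonneg_left hdef hM2d]

/-! ## §2 THE END with the sharp tent constants -/

/-- **THE COVARIANT ENERGY OF THE S7 COMPETITOR, SHARP CONSTANTS** (binders of file 5's `sum_normSq_gaugeDir_competitorW_le` verbatim: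
`M ≥ 2`, `N ≥ 1`, `d ≥ 1`; `W`, `U` unitary, `SmallField W a`, `SmallField U a_U`, `‖U − bseg M W‖ ≤ δ` bondwise, `U`, `b`, `c` `N`-periodic):
with `D = Σ_zΣ_α ‖gaugeDir U b z α‖²`, `S_b = Σ_z ‖b z‖²`, `S_h = Σ_z ‖c z − b z‖²`, `κ_a = 2(d−1)(M−1)a`, `K₁ = 8(dMa)² + (16∕M²)(δ + 9d²M²a)²`,
`K♯ = 16d²(d−1)²a_U² + 8(9d²M²a + dδ)²`:
`Σ_{y∈periodBox(M·N)} Σ_α ‖gaugeDir W (competitorW M W b c) y α‖²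
   ≤ 3·(2^{d+1}(M^d∕M²)·D + d·2^d·M^d·K₁·S_b) + 12d·S_h + 3·(d·2^{d+2}·(8∕M² + κ_a²))·(M^d·(4d·D + K♯·S_b) + (M^d)⁻¹·S_h)`. [folklore] -/
theorem sum_normSq_gaugeDir_competitorW_le_sharp {M N : ℕ} (hM : 2 ≤ M) (hN : 1 ≤ N) (hd : 0 < d)
    {W U : Site d → Fin d → (Matrix n n ℂ)ˣ} (hW : IsUnitaryCfg W) (hU : IsUnitaryCfg U) {a aU δ : ℝ} (ha : 0 ≤ a) (haU : 0 ≤ aU)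
    (hWa : SmallField W a) (hUa : SmallField U aU)
    (hδ : ∀ (w : Site d) (α : Fin d), ‖((U w α : (Matrix n n ℂ)ˣ) : Matrix n n ℂ) - bseg M W w α‖ ≤ δ)
    (hUP : IsPeriodicCfg U (N : ℤ)) {b c : Site d → Matrix n n ℂ}
    (hb : ∀ (z : Site d) (τ : Fin d), b (z + (N : ℤ) • e τ) = b z) (hc : ∀ (z : Site d) (τ : Fin d), c (z + (N : ℤ) • e τ) = c z) :
    ∑ y ∈ periodBox (d := d) (M * N), ∑ α : Fin d, ‖gaugeDir W (competitorW M W b c) y α‖ ^ 2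
      ≤ 3 * ((2 : ℝ) ^ (d + 1) * ((M : ℝ) ^ d / (M : ℝ) ^ 2) * ∑ z ∈ periodBox (d := d) N, ∑ α : Fin d, ‖gaugeDir U b z α‖ ^ 2
            + (d : ℝ) * (2 : ℝ) ^ d * (M : ℝ) ^ d
              * (8 * ((d : ℝ) * M * a) ^ 2 + (16 / (M : ℝ) ^ 2) * (δ + 9 * (d : ℝ) ^ 2 * (M : ℝ) ^ 2 * a) ^ 2)
              * ∑ z ∈ periodBox (d := d) N, ‖b z‖ ^ 2)
        + 12 * (d : ℝ) * ∑ z ∈ periodBox (d := d) N, ‖c z - b z‖ ^ 2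
        + 3 * ((d : ℝ) * (2 : ℝ) ^ (d + 2) * (8 / (M : ℝ) ^ 2 + (2 * (((d : ℝ) - 1) * ((M : ℝ) - 1) * a)) ^ 2))
          * ((M : ℝ) ^ d
              * (4 * (d : ℝ) * ∑ z ∈ periodBox (d := d) N, ∑ α : Fin d, ‖gaugeDir U b z α‖ ^ 2
                + (16 * (d : ℝ) ^ 2 * (((d : ℝ) - 1) * aU) ^ 2 + 8 * (9 * (d : ℝ) ^ 2 * (M : ℝ) ^ 2 * a + (d : ℝ) * δ) ^ 2)
                  * ∑ z ∈ periodBox (d := d) N, ‖b z‖ ^ 2)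
            + ((M : ℝ) ^ d)⁻¹ * ∑ z ∈ periodBox (d := d) N, ‖c z - b z‖ ^ 2) := by
  have hM1 : 1 ≤ M := by omega
  have hMd : (0 : ℝ) < (M : ℝ) ^ d := by
    have : (0 : ℝ) < M := by exact_mod_cast (by omega : 0 < M)
    positivity
  -- (1) the three pieces
  have hE1 := sum_normSq_gaugeDir_tinterpW_le hM1 hN hW hU ha hWa hδ hUP hb
  have hE2 := sum_normSq_gaugeDir_spikeW_le (M := M) hM1 hN hW (h := fun z => c z - b z) (fun z τ => by simp only [hb, hc])
  have hE3 := sum_normSq_gaugeDir_dressW_bump_le_tentSum hM N hW ha hWa (compCoef M W b c)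
  have hcoef := tentSum_sq_mul_sum_normSq_compCoef_le hM hN hd hW hU ha haU hWa hUa hδ hUP hb c
  -- (2) the bump piece through the coefficient: `C·(M^d)⁻¹·(tentSum²·Σ‖compCoef‖²) ≤ C·(M^d·(…) + (M^d)⁻¹·S_h)`
  set Cb : ℝ := (d : ℝ) * (2 : ℝ) ^ (d + 1) * (8 / (M : ℝ) ^ 2 + (2 * (((d : ℝ) - 1) * ((M : ℝ) - 1) * a)) ^ 2) with hCb
  have hCb0 : 0 ≤ Cb := by positivity
  have hE3' : ∑ y ∈ periodBox (d := d) (M * N), ∑ α : Fin d, ‖gaugeDir W (dressW M W (bump M (compCoef M W b c))) y α‖ ^ 2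
      ≤ Cb * ((M : ℝ) ^ d)⁻¹ * (2 * ((M : ℝ) ^ d) ^ 2
            * (4 * (d : ℝ) * ∑ z ∈ periodBox (d := d) N, ∑ α : Fin d, ‖gaugeDir U b z α‖ ^ 2
              + (16 * (d : ℝ) ^ 2 * (((d : ℝ) - 1) * aU) ^ 2 + 8 * (9 * (d : ℝ) ^ 2 * (M : ℝ) ^ 2 * a + (d : ℝ) * δ) ^ 2)
                * ∑ z ∈ periodBox (d := d) N, ‖b z‖ ^ 2)
        + 2 * ∑ z ∈ periodBox (d := d) N, ‖c z - b z‖ ^ 2) := by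
    have h1 : ∑ y ∈ periodBox (d := d) (M * N), ∑ α : Fin d, ‖gaugeDir W (dressW M W (bump M (compCoef M W b c))) y α‖ ^ 2
        ≤ Cb * ((M : ℝ) ^ d)⁻¹ * (tentSum d M ^ 2 * ∑ z ∈ periodBox (d := d) N, ‖compCoef M W b c z‖ ^ 2) := by
      refine hE3.trans (le_of_eq ?_); rw [hCb]; ring
    exact h1.trans (mul_le_mul_of_nonneg_left hcoef (by positivity))
  -- (3) split the covariant gradient of the sum into the three pieces
  have hsplit : ∀ (y : Site d) (α : Fin d), ‖gaugeDir W (competitorW M W b c) y α‖ ^ 2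
      ≤ 3 * ‖gaugeDir W (tinterpW M W b) y α‖ ^ 2 + 3 * ‖gaugeDir W (spikeW M fun z => c z - b z) y α‖ ^ 2
        + 3 * ‖gaugeDir W (dressW M W (bump M (compCoef M W b c))) y α‖ ^ 2 := by
    intro y α
    have h3 : gaugeDir W (competitorW M W b c) y α = gaugeDir W (tinterpW M W b) y α
        + gaugeDir W (spikeW M fun z => c z - b z) y α + gaugeDir W (dressW M W (bump M (compCoef M W b c))) y α := by
      have e1 : competitorW M W b c
          = fun x => (fun x' => tinterpW M W b x' + spikeW M (fun z => c z - b z) x') x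
              + dressW M W (bump M (compCoef M W b c)) x := rfl
      rw [e1, gaugeDir_add', gaugeDir_add']
    rw [h3]
    have h := norm_add₃_le (a := gaugeDir W (tinterpW M W b) y α) (b := gaugeDir W (spikeW M fun z => c z - b z) y α)
      (c := gaugeDir W (dressW M W (bump M (compCoef M W b c))) y α)
    calc _ ≤ (‖gaugeDir W (tinterpW M W b) y α‖ + ‖gaugeDir W (spikeW M fun z => c z - b z) y α‖
          + ‖gaugeDir W (dressW M W (bump M (compCoef M W b c))) y α‖) ^ 2 := pow_le_pow_left₀ (norm_nonneg _) h 2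
      _ ≤ _ := by
          nlinarith only [sq_nonneg (‖gaugeDir W (tinterpW M W b) y α‖ - ‖gaugeDir W (spikeW M fun z => c z - b z) y α‖),
            sq_nonneg (‖gaugeDir W (tinterpW M W b) y α‖ - ‖gaugeDir W (dressW M W (bump M (compCoef M W b c))) y α‖),
            sq_nonneg (‖gaugeDir W (spikeW M fun z => c z - b z) y α‖
              - ‖gaugeDir W (dressW M W (bump M (compCoef M W b c))) y α‖)]
  have hsum : ∑ y ∈ periodBox (d := d) (M * N), ∑ α : Fin d, ‖gaugeDir W (competitorW M W b c) y α‖ ^ 2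
      ≤ 3 * ∑ y ∈ periodBox (d := d) (M * N), ∑ α : Fin d, ‖gaugeDir W (tinterpW M W b) y α‖ ^ 2
        + 3 * ∑ y ∈ periodBox (d := d) (M * N), ∑ α : Fin d, ‖gaugeDir W (spikeW M fun z => c z - b z) y α‖ ^ 2
        + 3 * ∑ y ∈ periodBox (d := d) (M * N), ∑ α : Fin d, ‖gaugeDir W (dressW M W (bump M (compCoef M W b c))) y α‖ ^ 2 := by
    refine (Finset.sum_le_sum fun y _ => Finset.sum_le_sum fun α _ => hsplit y α).trans (le_of_eq ?_)
    simp only [Finset.sum_add_distrib, Finset.mul_sum]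
  -- (4) assemble
  have hfinal : 3 * (Cb * ((M : ℝ) ^ d)⁻¹ * (2 * ((M : ℝ) ^ d) ^ 2
            * (4 * (d : ℝ) * ∑ z ∈ periodBox (d := d) N, ∑ α : Fin d, ‖gaugeDir U b z α‖ ^ 2
              + (16 * (d : ℝ) ^ 2 * (((d : ℝ) - 1) * aU) ^ 2 + 8 * (9 * (d : ℝ) ^ 2 * (M : ℝ) ^ 2 * a + (d : ℝ) * δ) ^ 2)
                * ∑ z ∈ periodBox (d := d) N, ‖b z‖ ^ 2)
        + 2 * ∑ z ∈ periodBox (d := d) N, ‖c z - b z‖ ^ 2))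
      = 3 * ((d : ℝ) * (2 : ℝ) ^ (d + 2) * (8 / (M : ℝ) ^ 2 + (2 * (((d : ℝ) - 1) * ((M : ℝ) - 1) * a)) ^ 2))
          * ((M : ℝ) ^ d
              * (4 * (d : ℝ) * ∑ z ∈ periodBox (d := d) N, ∑ α : Fin d, ‖gaugeDir U b z α‖ ^ 2
                + (16 * (d : ℝ) ^ 2 * (((d : ℝ) - 1) * aU) ^ 2 + 8 * (9 * (d : ℝ) ^ 2 * (M : ℝ) ^ 2 * a + (d : ℝ) * δ) ^ 2)
                  * ∑ z ∈ periodBox (d := d) N, ‖b z‖ ^ 2)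
            + ((M : ℝ) ^ d)⁻¹ * ∑ z ∈ periodBox (d := d) N, ‖c z - b z‖ ^ 2) := by
    rw [hCb, pow_succ (2 : ℝ) (d + 1)]
    field_simp
  linarith only [hsum, hE1, hE2, hE3', hfinal.le, hfinal.ge]

end

end Summit.QuantumFields.BalabanUV.T4Continuum.NE3CovariantCompetitorSharp
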